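import Literature.NumberTheory.LFunctions.ZetaFirstZeroCertificate
import Literature.NumberTheory.LFunctions.HardyZSignCertificate
import HarnessLib

/-!
# Backlund's certificate at height `19`: `N(19) = N₀(19) = 1`, RH up to `19`, and `Z(19) > 0`

Trunk T-ANT (`NumberTheory/LFunctions`) with T-VALNUM. A third accepted certificate for the
kernel-checked Backlund format `Literature.NumberTheory.LFunctions.ZetaCert.RHCert` of
`ZetaArgumentCertificate.lean` (after `RH16.theCert` there and `RH14.theCert` in
`ZetaFirstZeroCertificate.lean`), at height `T = 19`, i.e. between the first Gram point
`g_0 = 17.845…` and the second zero `γ₁ = 21.022…` of `ζ`: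

* `RH19.theCert`, `RH19.theCert_check` — three pieces `[½, 1]`, `[1, 3/2]`, `[3/2, 2]` of the top
  edge `[½, 2] × {19}` with label `0` (`Re ζ(σ + 19i) > 0`; numerically `Re ζ ∈ [1.19, 1.63]`
  there), the bracket `[225/16, 227/16]` of `RH16` around `γ₀ = 14.1347…`, the logarithm table of
  `RH16` (`K = 20`), exponent `j = 5` (`19/2⁵ ∈ [½, 1]`); accepted by `decide +kernel`.
* `riemannHypothesisUpTo_nineteen`, `zetaZeroCount_nineteen : N(19) = 1`,
  `criticalZeroCount_nineteen : N₀(19) = 1`: the first zero is the only zero of `ζ` with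
  `0 < Im ρ ≤ 19`, and it is simple and on the line.
* `re_riemannZeta_pos_nineteen` — `Re ζ(x + 19i) > 0` for `½ ≤ x ≤ 1` (the first piece, read
  pointwise through `Piece.re_qrot_pos_Icc`), in particular `Re ζ(½ + 19i) > 0`.
* `riemannSiegelTheta_nineteen_pos`, `riemannSiegelTheta_nineteen_lt` — `0 < ϑ(19) < π/2` from the
  explicit Stirling bound `Literature.NumberTheory.LFunctions.abs_riemannSiegelTheta_sub_stirling_le`
  (numerically `ϑ(19) = 0.6207…`); hence `hardyZ_nineteen_pos : Z(19) > 0`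
  (`Literature.NumberTheory.LFunctions.hardyZ_pos_of_re_pos` with `φ = 0`).

These are the numerical anchors of Edwards' induction "Rosser's rule ⟹ `S(g_n) ≥ −1`"
(*Riemann's Zeta Function*, §8.4), which starts from "the Gram point `g_0` is good and
`N(g_0) = 1`" (`Literature/Barriers/RiemannHypothesis/GramRosserFailuresRosserRHProofs.lean`).
The piece data (cut-offs `N`, bounds `M0 ≥ |s|`, `m1 ≤ |s − 1|`, `N2`) were chosen by hand from a
floating-point evaluation outside Lean; only the kernel's verdict is used.

## References

* H. M. Edwards, *Riemann's Zeta Function*, Academic Press 1974, §6.5 (`g_0 = 17.8455`,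
  table of `ϑ`), §6.6 (Backlund's determination of `N(T)`), §8.4. [Edwards1974]
* E. C. Titchmarsh, *The Theory of the Riemann Zeta-Function*, 2nd ed. 1986, §9.1, §15.2
  (`γ₁ = 14.13`, `γ₂ = 21.02`). [Titchmarsh1986]
-/

noncomputable section

open Literature.Analysis.Complex Complex Set

namespace Literature.NumberTheory.LFunctions.ZetaCert

/-! ## The certificate for `T = 19` -/

namespace RH19

/-- First piece of the top edge: `[½, 1] × {19}`, label `0` (`Re ζ > 0`). [folklore] -/
def P₁ : Piece :=
  ⟨⟨((1 : ℚ) / 2), (19 : ℚ), 16, ((1217 : ℚ) / 64)⟩,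
    ⟨(1 : ℚ), (19 : ℚ), 14, ((609 : ℚ) / 32)⟩, 0, 6, ((609 : ℚ) / 32), (19 : ℚ)⟩

/-- Second piece of the top edge: `[1, 3/2] × {19}`, label `0`. [folklore] -/
def P₂ : Piece :=
  ⟨⟨(1 : ℚ), (19 : ℚ), 14, ((609 : ℚ) / 32)⟩,
    ⟨((3 : ℚ) / 2), (19 : ℚ), 12, ((1221 : ℚ) / 64)⟩, 0, 6, ((1221 : ℚ) / 64), (19 : ℚ)⟩

/-- Third piece of the top edge: `[3/2, 2] × {19}`, label `0`. [folklore] -/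
def P₃ : Piece :=
  ⟨⟨((3 : ℚ) / 2), (19 : ℚ), 12, ((1221 : ℚ) / 64)⟩,
    ⟨(2 : ℚ), (19 : ℚ), 10, ((153 : ℚ) / 8)⟩, 0, 6, ((153 : ℚ) / 8), (19 : ℚ)⟩

/-- Pieces of the top edge `½ + 19i → 2 + 19i`. [folklore] -/
def theTop : List Piece := [P₁, P₂, P₃]

/-- **The certificate for `T = 19`**: the logarithm table and the bracket of `RH16`
(`[225/16, 227/16]` around `γ₀`), the three pieces above, exponent `j = 5`. [folklore] -/
def theCert : RHCert := ⟨19, RH16.theLogs, theTop, RH16.theBrackets, 5⟩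

/-- **The checker accepts the certificate** (kernel evaluation). [folklore] -/
theorem theCert_check : theCert.check = true := by
  decide +kernel

/-- The first piece passes the piece check on its own (used pointwise below). [folklore] -/
theorem P₁_check : P₁.check RH16.theLogs 20 = true := by
  decide +kernel

end RH19

end Literature.NumberTheory.LFunctions.ZetaCert

namespace Literature.NumberTheory.LFunctions

open ZetaCert

/-- **The Riemann hypothesis up to height `19`**: every zero `ρ` of `ζ` with `0 < Im ρ ≤ 19` has
`Re ρ = 1/2`. [cite: Edwards1974, §6.6] -/
theorem riemannHypothesisUpTo_nineteen : DiophantineGeometry.RiemannHypothesisUpTo 19 := by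
  have h := RHCert.sound RH19.theCert_check
  norm_num [RH19.theCert] at h
  exact h

/-- **`N(19) = 1`**: the first zero `ρ₀ = ½ + iγ₀` (`γ₀ = 14.13…`) is the only zero of `ζ` with
`0 < Im ρ ≤ 19`, and it is simple. [cite: Edwards1974, §6.6] -/
theorem zetaZeroCount_nineteen : zetaZeroCount 19 = 1 := by
  have h := RHCert.zetaZeroCount_eq_length RH19.theCert_check
  norm_num [RH19.theCert, RH16.theBrackets] at h
  exact h

/-- `N₀(19) = 1`. [cite: Edwards1974, §6.6] -/
theorem criticalZeroCount_nineteen : criticalZeroCount 19 = 1 := by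
  have h := RHCert.criticalZeroCount_eq_length RH19.theCert_check
  norm_num [RH19.theCert, RH16.theBrackets] at h
  exact h

/-- **`Re ζ(x + 19i) > 0` for `½ ≤ x ≤ 1`** (the first piece of the certificate, pointwise).
[folklore] -/
theorem re_riemannZeta_pos_nineteen {x : ℝ} (hx : x ∈ Icc (1 / 2 : ℝ) 1) :
    0 < (riemannZeta (x + 19 * I)).re := by
  have hl : LogsValid RH16.theLogs 20 := logsValid_of_check (by decide +kernel)
  have h := Piece.re_qrot_pos_Icc hl RH19.P₁_check (x := x) (by norm_num [RH19.P₁]; exact hx)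
  have e1 : qrot RH19.P₁.d = 1 := rfl
  have e2 : ((RH19.P₁.a.t : ℚ) : ℝ) = 19 := by norm_num [RH19.P₁]
  rwa [e1, one_mul, e2] at h

/-- `19/(2π) > e · 1.101…`: the elementary inequality `1.1 < log(19/(2π))` (`log y ≥ 1 − 1/y` at
`y = 19/(2πe)`, `e < 2.71828183`, `π < 3.1416`). [folklore] -/
theorem log_nineteen_div_two_pi_gt : 1.1 < Real.log (19 / (2 * Real.pi)) := by
  have hπ0 : 0 < Real.pi := Real.pi_pos
  have hπ : Real.pi < 3.1416 := Real.pi_lt_d4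
  have he : Real.exp 1 < 2.7182818286 := Real.exp_one_lt_d9
  have he0 : 0 < Real.exp 1 := Real.exp_pos 1
  have hx0 : 0 < 19 / (2 * Real.pi) := by positivity
  -- `log x = 1 + log (x / e)` and `log (x/e) ≥ 1 − e/x`
  have h1 : Real.log (19 / (2 * Real.pi)) = 1 + Real.log (19 / (2 * Real.pi) / Real.exp 1) := by
    rw [Real.log_div hx0.ne' he0.ne', Real.log_exp]; ring
  have h2 := Real.one_sub_inv_le_log_of_pos (x := 19 / (2 * Real.pi) / Real.exp 1) (by positivity)
  have h3 : (19 / (2 * Real.pi) / Real.exp 1)⁻¹ = 2 * Real.pi * Real.exp 1 / 19 := by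
    field_simp
  rw [h3] at h2
  nlinarith

/-- `log(19/(2π)) < 1.18` (`log x = 2 log 2 + log(x/4)`, `log y ≤ y − 1`, `log 2 < 0.6931471808`,
`π > 3`). [folklore] -/
theorem log_nineteen_div_two_pi_lt : Real.log (19 / (2 * Real.pi)) < 1.18 := by
  have hπ0 : 0 < Real.pi := Real.pi_pos
  have hπ3 : 3 < Real.pi := Real.pi_gt_three
  have hx0 : 0 < 19 / (2 * Real.pi) := by positivity
  have h1 : Real.log (19 / (2 * Real.pi)) = 2 * Real.log 2 + Real.log (19 / (2 * Real.pi) / 4) := by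
    rw [Real.log_div hx0.ne' (by norm_num), show (4 : ℝ) = 2 ^ 2 by norm_num, Real.log_pow]
    push_cast
    ring
  have h2 := Real.log_le_sub_one_of_pos (x := 19 / (2 * Real.pi) / 4) (by positivity)
  have h3 : 19 / (2 * Real.pi) / 4 < 19 / 24 := by
    rw [div_div, div_lt_div_iff_of_pos_left (by norm_num) (by positivity) (by norm_num)]
    linarith
  have h4 : Real.log 2 < 0.6931471808 := Real.log_two_lt_d9
  linarith

/-- **`ϑ(19) > 0`** (numerically `ϑ(19) = 0.6207…`; Edwards' table, §6.5, has `g_0 = 17.8455 < 19`),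
from the explicit Stirling bound with `K(¼) < 0.6`. [cite: Edwards1974, §6.5] -/
theorem riemannSiegelTheta_nineteen_pos : 0 < riemannSiegelTheta 19 := by
  have hπ0 : 0 < Real.pi := Real.pi_pos
  have hπ : Real.pi < 3.1416 := Real.pi_lt_d4
  have h := abs_riemannSiegelTheta_sub_stirling_le (t := 19) (by norm_num)
  have hK : stirlingVertRate (1 / 4) < 0.6 := by
    rw [stirlingVertRate]; nlinarith
  have hlog := log_nineteen_div_two_pi_gt
  have h1 := (abs_le.1 h).1
  have hK' : 2 * stirlingVertRate (1 / 4) / 19 < 0.07 := by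
    rw [div_lt_iff₀ (by norm_num)]; linarith
  nlinarith

/-- **`ϑ(19) < π/2`** (numerically `0.6207…`). [cite: Edwards1974, §6.5] -/
theorem riemannSiegelTheta_nineteen_lt : riemannSiegelTheta 19 < Real.pi / 2 := by
  have hπ0 : 0 < Real.pi := Real.pi_pos
  have hπ3 : 3 < Real.pi := Real.pi_gt_three
  have h := abs_riemannSiegelTheta_sub_stirling_le (t := 19) (by norm_num)
  have hK : stirlingVertRate (1 / 4) < 0.6 := by
    have hπ : Real.pi < 3.1416 := Real.pi_lt_d4
    rw [stirlingVertRate]; nlinarith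
  have hlog := log_nineteen_div_two_pi_lt
  have h2 := (abs_le.1 h).2
  have hK' : 2 * stirlingVertRate (1 / 4) / 19 < 0.07 := by
    rw [div_lt_iff₀ (by norm_num)]; linarith
  nlinarith

/-- **`Z(19) > 0`**: `Re ζ(½ + 19i) > 0` and `|ϑ(19)| < π/2`, so `Z(19) = Re(e^{iϑ(19)} ζ(½ + 19i))`
has the sign of `Re ζ(½ + 19i)` (`hardyZ_pos_of_re_pos` with `φ = 0`). Numerically
`Z(19) = 1.99…`. [cite: Edwards1974, §6.5] -/
theorem hardyZ_nineteen_pos : 0 < hardyZ 19 := by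
  refine hardyZ_pos_of_re_pos (φ := 0) ?_ ?_
  · rw [zero_sub, abs_neg, abs_of_pos riemannSiegelTheta_nineteen_pos]
    exact riemannSiegelTheta_nineteen_lt
  · have h := re_riemannZeta_pos_nineteen (x := 1 / 2) ⟨le_rfl, by norm_num⟩
    push_cast at h
    simpa using h

end Literature.NumberTheory.LFunctions
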